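import Summits.QuantumFields.YangMills.Theorems.BalabanUVNodesN07FlatHessianCurlCurlAdapter
import Literature.MathematicalPhysics.QuantumFieldTheory.Balaban1983to89.Node00.CriticalOnFibre
import Literature.MathematicalPhysics.QuantumFieldTheory.Balaban1983to89.Node00.AveragingSmooth
import HarnessLib

/-!
# N07 [B11] ∕ K0 road (Q2): **THE SOCKET EQUATION FROM THE RECORD's CRITICALITY, ONE KERNEL DIRECTION AT A TIME** — if the chart line `s ↦ exp(Φ(A′₀ + sδ))`
# stays in the fibre of record (n07-e's `IsCritOnFibre` datum `𝔹, W`) and the action in chart coordinates is `½⟪·, Δ_1·⟫ + V` along that line ([15] (157),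
# p627407), then **`⟪δ, Δ_1A′₀⟫ + ∂_δV(A′₀) = 0`** — [15] (127)∕(128) in S1's currency; with a Frobenius gradient field `Wf` of `V` on the record kernel this IS
# the `h127rec` binder of k0-s1-w1's `exists_correctedCurrent_of_slice_lieSU` (via p624107)

Cell `pub-ymgap` (HUMAN RULING D-0062 ∕ D-0149), Track A node N07 = [Balaban1985Variational]; width seat `pub-ymgap-dag-n07-w1` (g6), lane S1∕D4.
`--kind proof --supports stmt-QuantumFields-27364 --as helper` (K1⁹; count-neutral).  [15] = [Balaban1985Variational]; [III] = [Balaban1988Convergent].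

WHY.  k0-s1-w1's corrected-current junction (p618723 ∕ p620347 ∕ p625278) consumes ONE displayed input, the SOCKET `h127rec`: «for every 𝔰𝔲(N)-valued test `δ` in the
record's multi-level kernel, `Σ_b Re tr(δ_bᴴ((K_V A′)_b + Wf_b)) = 0`» — the record's criticality in the coordinates of the chart (47).  Its producer was unowned
(k0-s1-w1 g6 I.35624: «the producer of `h127rec` itself … remains S2∕S4b's»).  This file types the producer's SPINE with every analytic input displayed BY ITS OWNER's
LETTER: (i) `hcrit` — the record's configuration `exp(Φ A′₀)` is critical on the fibre in the CURVE form (`Node00.IsCritOnFibre`; from «(2.12) minimiser over the open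
class» by `Node00.isCritOnFibre_of_isMinimizer_classTop` ∕ `…_of_eventually_mem`, K0 road §0–§1); (ii) `hfib` — the chart line `exp(Φ(A′₀ + sδ))` stays in that fibre
for small `s` (THE defining property of print's (47) `Φ A′ = A′ − H·D(A′)` on the affine kernel space `QA′ = B`, S2's chart); (iii) `hΦ` — differentiability of the chart
along the line (S2: `K0Stub1ChartDAnalytic.contDiffOn_chartD`); (iv) `h157` — the action in chart coordinates along the line is `½⟪·, Δ_1·⟫ + V` (p627407
`wilsonAction4_expChart_one_chart_eq157` with `Dd := Dfun(A′)`); (v) `hV` — the derivative of `V` along the line (S4b's W-certificate `HasFDerivAt V (BE (W A′)) A′`,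
p612123 ∕ p621022 ∕ p623337, read in the Frobenius currency).  OUTPUT: the socket equation, and — quantified over the record kernel with a gradient field `Wf` — D's
`h127rec` binder verbatim (current `(N·c²)•Wf`, p624107 `socket_curlCurlExt_iff_socket_hessOpAt_inner`).

WHAT IS PROVED (sorry-free; no definition; axioms standard; `E := TangentBondSU (F.P K) 0 N`, `⇑` = `WithLp.ofLp`).
* §1 `inner_hessOpAt_line_eq` (the quadratic form along a line is the displayed quadratic polynomial), ★ `hasDerivAt_inner_hessOpAt_line` —
  `d∕ds|₀ ½⟪A₀ + sδ, Δ_{U₀}(A₀ + sδ)⟫ = ⟪δ, Δ_{U₀}A₀⟫` (symmetry of S1's `hessOpAt`, any background).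
* §2 ★★ `hasDerivAt_wilsonAction4_chartLine_zero` — (i)+(ii)+(iii) ⇒ `d∕ds|₀ 𝔄(exp ⇑(Φ(A₀ + sδ))) = 0` (`Node00.isCritOnFibre_iff_hasDerivAt_zero` on the curve
  `s ↦ exp ⇑(Φ(A₀ + sδ))`, differentiable by `Node00.contDiff_coeField_expChart`).
* §3 ★★★ `inner_hessOpAt_add_eq_zero_of_isCritOnFibre` — (i)–(v) ⇒ **`⟪δ, Δ_1A₀⟫ + v = 0`** for the line derivative `v` of `V` ([15] (127) at the record, one direction).
* §5 (v1.1) the same three with the FIBRE ABSTRACTED to any set `𝓕` of configurations carrying curve-criticality (`…_of_mem` editions, generic torus `P`) — for the ♭ road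
  (chart lines stay in the ♭ functional's fibres) and gauge-transported readings; `curveCritical_of_isCritOnFibre` recovers §2–§4's instance.
* §4 ★★★ `h127rec_of_isCritOnFibre` — for a nested family `Dm`, the record kernel `∀ j e, Dm.LamBond j e → dIterL j 1 ⇑δ e = 0`, hypotheses (ii)(iii)(v) for every such
  `δ` with `v = Σ_b Re tr((δ b)ᴴ Wf_b)` and (i), (iv): D's binder «`∀ δ : PBond → 𝔰𝔲(N)`, record kernel `→ Σ_b Re tr(δ_bᴴ((K_V ⇑A₀)_b + (N·c²)•Wf_b)) = 0`».
HONEST SCOPE.  A junction: calculus bookkeeping (product rule on a quadratic polynomial, uniqueness of derivatives) over kernel-checked NODE 00 ∕ S1 objects; NO estimate;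
the displayed inputs (i)–(v) are NOT produced here — (ii)(iii) are S2's chart facts, (v) is S4b's certificate, (i) is the K0 road's minimiser-to-criticality step, (iv) is
p627407 instantiated at S2's `Dfun`; nothing of Bałaban's analysis asserted; `stub_prop8StepCoP13` ∕ K0⁷ ∕ K1⁹ NOT closed; N07 NOT discharged; counts unmoved (28∕28 ·
5∕27); one finite 𝕋⁴ programme at fixed ε — R4 closes the conditional finite-𝕋⁴ rung `BalabanLadder.UV` only, never the summit; the YM mass gap (Clay) is NOT proved by
any of this; nothing continuum ∕ ℝ⁴ ∕ OS.  No `sorry`, no `def`, no `instance`, no `notation`.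

References: [15] (47) p.285, (82)–(83) p.290, (127)–(128) p.297, (157) p.302; [III] (2.10)–(2.12) p.256; [Balaban1985BackgroundPropagators] (3.10) p.392.
-/

set_option autoImplicit false
noncomputable section
open scoped BigOperators Matrix InnerProductSpace RealInnerProductSpace Matrix.Norms.L2Operator Topology
open Filter

namespace Summit.QuantumFields.YangMills.BalabanUVNodes.N07SocketOfChartedCriticality

open Literature.MathematicalPhysics.QuantumFieldTheory.Balaban1983to89
open Literature.MathematicalPhysics.QuantumFieldTheory.Balaban1983to89.Node00
open T4Continuum (T4Family)
open T4AdjointCovarianceUnitary (lieSU)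
open B15DeterminingSets (DetSet MSField AgreeOn avgFamily)
open B6SectADomainsV1 (Domains)
open B6SectAOperatorsV1 (dcE dcsE)
open Summit.QuantumFields.YangMills.BalabanUVNodes.N07FlatHessianCurlCurlAdapter (socket_curlCurlExt_iff_socket_hessOpAt_inner)

variable {P : Params} {N : ℕ} {j : ℕ}

/-! ## §1  The quadratic form of S1's Hessian along a line -/

/-- `½⟪A₀ + sδ, Δ(A₀ + sδ)⟫ = ½⟪A₀, ΔA₀⟫ + s·⟪δ, ΔA₀⟫ + ½s²·⟪δ, Δδ⟫` for the symmetric `Δ_{U₀} = hessOpAt η U₀`. [cite: Balaban1985BackgroundPropagators, (3.10) p.392] -/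
theorem inner_hessOpAt_line_eq (η : ℝ) (U₀ : GaugeField P j (SU N)) (A₀ δ : TangentBondSU P j N) (s : ℝ) :
    2⁻¹ * ⟪A₀ + s • δ, hessOpAt η U₀ (A₀ + s • δ)⟫_ℝ =
      2⁻¹ * ⟪A₀, hessOpAt η U₀ A₀⟫_ℝ + s * ⟪δ, hessOpAt η U₀ A₀⟫_ℝ + 2⁻¹ * s ^ 2 * ⟪δ, hessOpAt η U₀ δ⟫_ℝ := by
  have hsymm : ⟪A₀, hessOpAt η U₀ δ⟫_ℝ = ⟪δ, hessOpAt η U₀ A₀⟫_ℝ := by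
    rw [← hessOpAt_isSymmetric η U₀ δ A₀, real_inner_comm]
  rw [map_add, map_smul, inner_add_left, inner_add_right, inner_add_right, inner_smul_left, inner_smul_left, inner_smul_right, inner_smul_right,
    hsymm]
  simp only [conj_trivial]
  ring

/-- ★ **`d∕ds|₀ ½⟪A₀ + sδ, Δ_{U₀}(A₀ + sδ)⟫ = ⟪δ, Δ_{U₀}A₀⟫`**. [cite: Balaban1985Variational, (127) p.297; Balaban1985BackgroundPropagators, (3.10) p.392] -/
theorem hasDerivAt_inner_hessOpAt_line (η : ℝ) (U₀ : GaugeField P j (SU N)) (A₀ δ : TangentBondSU P j N) :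
    HasDerivAt (fun s : ℝ => 2⁻¹ * ⟪A₀ + s • δ, hessOpAt η U₀ (A₀ + s • δ)⟫_ℝ) ⟪δ, hessOpAt η U₀ A₀⟫_ℝ 0 := by
  have hfun : (fun s : ℝ => 2⁻¹ * ⟪A₀ + s • δ, hessOpAt η U₀ (A₀ + s • δ)⟫_ℝ) =
      fun s => 2⁻¹ * ⟪A₀, hessOpAt η U₀ A₀⟫_ℝ + s * ⟪δ, hessOpAt η U₀ A₀⟫_ℝ + 2⁻¹ * s ^ 2 * ⟪δ, hessOpAt η U₀ δ⟫_ℝ :=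
    funext (inner_hessOpAt_line_eq η U₀ A₀ δ)
  rw [hfun]
  have h1 : HasDerivAt (fun s : ℝ => s * ⟪δ, hessOpAt η U₀ A₀⟫_ℝ) (1 * ⟪δ, hessOpAt η U₀ A₀⟫_ℝ) 0 := (hasDerivAt_id (0 : ℝ)).mul_const _
  have h2 : HasDerivAt (fun s : ℝ => 2⁻¹ * s ^ 2 * ⟪δ, hessOpAt η U₀ δ⟫_ℝ) (2⁻¹ * ((2 : ℕ) * (0 : ℝ) ^ (2 - 1) * 1) * ⟪δ, hessOpAt η U₀ δ⟫_ℝ) 0 :=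
    (((hasDerivAt_id (0 : ℝ)).pow 2).const_mul 2⁻¹).mul_const _
  have h := ((hasDerivAt_const (0 : ℝ) (2⁻¹ * ⟪A₀, hessOpAt η U₀ A₀⟫_ℝ)).add h1).add h2
  refine h.congr_deriv ?_
  norm_num

/-! ## §2  Criticality along a chart line staying in the fibre -/

section Crit

variable {F : T4Family} [NeZero N]

/-- ★★ **CRITICALITY ALONG THE CHART LINE**: if the configuration `exp ⇑(Φ A₀)` is critical on the fibre `𝔅(𝔹, W)` of the averaging of record in the curve form
(`Node00.IsCritOnFibre`), the chart line `s ↦ exp ⇑(Φ(A₀ + sδ))` stays in that fibre for small `s`, and `s ↦ Φ(A₀ + sδ)` is differentiable at `0`, then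
`d∕ds|₀ 𝔄(exp ⇑(Φ(A₀ + sδ))) = 0` — the curve is admissible for the predicate (`Node00.contDiff_coeField_expChart`), so `isCritOnFibre_iff_hasDerivAt_zero` applies.
[cite: Balaban1985Variational, (82)-(83) p.290, (47) p.285; Balaban1988Convergent, (2.12) p.256] -/
theorem hasDerivAt_wilsonAction4_chartLine_zero {K : ℕ} {𝔹 : DetSet (F.P K)} {W : MSField (F.P K) (SU N)}
    (Φ : TangentBondSU (F.P K) 0 N → TangentBondSU (F.P K) 0 N) (A₀ δ : TangentBondSU (F.P K) 0 N)
    (hΦ : DifferentiableAt ℝ (fun s : ℝ => Φ (A₀ + s • δ)) 0)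
    (hfib : ∀ᶠ s in 𝓝 (0 : ℝ), AgreeOn 𝔹 (avgFamily (avOfRecord F N K) (expChart 1 (WithLp.ofLp (Φ (A₀ + s • δ))))) W)
    (hcrit : IsCritOnFibre F N K 𝔹 W (expChart 1 (WithLp.ofLp (Φ A₀)))) :
    HasDerivAt (fun s : ℝ => wilsonAction4 (expChart (1 : GaugeField (F.P K) 0 (SU N)) (WithLp.ofLp (Φ (A₀ + s • δ))))) 0 0 := by
  -- the line in the plain function space, differentiable through the continuous linear `ofLp`
  have hline : DifferentiableAt ℝ (fun s : ℝ => WithLp.ofLp (Φ (A₀ + s • δ))) 0 :=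
    (PiLp.continuousLinearEquiv 2 ℝ (fun _ : PBond (F.P K) 0 => lieSU (Fin N))).differentiableAt.comp (0 : ℝ) hΦ
  have hd : DifferentiableAt ℝ (fun (s : ℝ) (b : PBond (F.P K) 0) =>
      ((expChart (1 : GaugeField (F.P K) 0 (SU N)) (WithLp.ofLp (Φ (A₀ + s • δ))) b : SU N) : Matrix (Fin N) (Fin N) ℂ)) 0 :=
    (((contDiff_coeField_expChart (1 : GaugeField (F.P K) 0 (SU N))).differentiable (by simp)).differentiableAt).comp (0 : ℝ) hline
  have h0 : (fun s : ℝ => expChart (1 : GaugeField (F.P K) 0 (SU N)) (WithLp.ofLp (Φ (A₀ + s • δ)))) 0 = expChart 1 (WithLp.ofLp (Φ A₀)) := by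
    simp only [zero_smul, add_zero]
  exact (isCritOnFibre_iff_hasDerivAt_zero.mp hcrit) _ h0 hd hfib

/-! ## §3  (127) at the record, one direction: `⟪δ, Δ_1A₀⟫ + ∂_δV(A₀) = 0` -/

/-- ★★★ **THE SOCKET EQUATION FROM CRITICALITY.**  With (i) `hcrit`, (ii) `hfib`, (iii) `hΦ` as in §2, (iv) the (157) identity along the line
`𝔄(exp ⇑(Φ(A₀ + sδ))) = ½⟪A₀ + sδ, Δ_1(A₀ + sδ)⟫ + V(A₀ + sδ)` (p627407 with `Dd := D(A′)`) and (v) the line derivative `v` of `V`:  **`⟪δ, Δ_1A₀⟫ + v = 0`**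
(uniqueness of the derivative of `s ↦ 𝔄(exp ⇑(Φ(A₀ + sδ)))`: `0` by §2, `⟪δ, Δ_1A₀⟫ + v` by §1 and (iv)).
[cite: Balaban1985Variational, (127)-(128) p.297, (157) p.302, (82)-(83) p.290] -/
theorem inner_hessOpAt_add_eq_zero_of_isCritOnFibre {K : ℕ} {𝔹 : DetSet (F.P K)} {W : MSField (F.P K) (SU N)} {η : ℝ}
    (Φ : TangentBondSU (F.P K) 0 N → TangentBondSU (F.P K) 0 N) (V : TangentBondSU (F.P K) 0 N → ℝ) (A₀ δ : TangentBondSU (F.P K) 0 N)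
    (hΦ : DifferentiableAt ℝ (fun s : ℝ => Φ (A₀ + s • δ)) 0)
    (hfib : ∀ᶠ s in 𝓝 (0 : ℝ), AgreeOn 𝔹 (avgFamily (avOfRecord F N K) (expChart 1 (WithLp.ofLp (Φ (A₀ + s • δ))))) W)
    (hcrit : IsCritOnFibre F N K 𝔹 W (expChart 1 (WithLp.ofLp (Φ A₀))))
    (h157 : ∀ s : ℝ, wilsonAction4 (expChart (1 : GaugeField (F.P K) 0 (SU N)) (WithLp.ofLp (Φ (A₀ + s • δ)))) =
      2⁻¹ * ⟪A₀ + s • δ, hessOpAt η (1 : GaugeField (F.P K) 0 (SU N)) (A₀ + s • δ)⟫_ℝ + V (A₀ + s • δ))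
    {v : ℝ} (hV : HasDerivAt (fun s : ℝ => V (A₀ + s • δ)) v 0) :
    ⟪δ, hessOpAt η (1 : GaugeField (F.P K) 0 (SU N)) A₀⟫_ℝ + v = 0 := by
  have hzero := hasDerivAt_wilsonAction4_chartLine_zero Φ A₀ δ hΦ hfib hcrit
  have hsum : HasDerivAt (fun s : ℝ => wilsonAction4 (expChart (1 : GaugeField (F.P K) 0 (SU N)) (WithLp.ofLp (Φ (A₀ + s • δ)))))
      (⟪δ, hessOpAt η (1 : GaugeField (F.P K) 0 (SU N)) A₀⟫_ℝ + v) 0 := by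
    rw [show (fun s : ℝ => wilsonAction4 (expChart (1 : GaugeField (F.P K) 0 (SU N)) (WithLp.ofLp (Φ (A₀ + s • δ))))) =
        fun s => 2⁻¹ * ⟪A₀ + s • δ, hessOpAt η (1 : GaugeField (F.P K) 0 (SU N)) (A₀ + s • δ)⟫_ℝ + V (A₀ + s • δ) from funext h157]
    exact (hasDerivAt_inner_hessOpAt_line η 1 A₀ δ).add hV
  exact hsum.unique hzero

/-! ## §4  Over the record kernel with a gradient field: D's `h127rec` binder -/

/-- ★★★ **`h127rec` FROM THE RECORD's CRITICALITY.**  For a nested family `Dm`, the kernel-formula letter `K_V` of `dcsE c ∘ dcE c`, `η ≠ 0`, `c ≠ 0`, a chart `Φ` and a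
functional `V` on `E` with: (i) `exp ⇑(Φ A₀)` critical on the fibre `𝔅(𝔹, W)`; for EVERY `δ ∈ E` in the RECORD's multi-level kernel (`Dm.LamBond j e → dIterL j 1 ⇑δ e = 0`):
(ii) the chart line through `A₀` in the direction `δ` stays in the fibre, (iii) is differentiable, (iv) carries the (157) identity, and (v) `V` has line derivative
`Σ_b Re tr((δ b)ᴴ Wf_b)` (a Frobenius gradient field `Wf` on the kernel) — THEN the `h127rec` binder of k0-s1-w1's `exists_correctedCurrent_of_slice_lieSU` holds with Hessian
letter `K_V` and current `(N·c²)•Wf`: «`∀ δ : PBond → 𝔰𝔲(N)`, record kernel `→ Σ_b Re tr(δ_bᴴ((K_V ⇑A₀)_b + (N·c²)•Wf_b)) = 0`».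
[cite: Balaban1985Variational, (127)-(128) p.297, (157) p.302; Balaban1984PropagatorsII, (2.19) p.226] -/
theorem h127rec_of_isCritOnFibre {K : ℕ} {𝔹 : DetSet (F.P K)} {W : MSField (F.P K) (SU N)} {η : ℝ} (hη : η ≠ 0) {c : ℝ} (hc : c ≠ 0)
    (Dm : Domains (F.P K)) {instDE : DecidableEq (PBond (F.P K) 0)}
    {KV : (PBond (F.P K) 0 → Matrix (Fin N) (Fin N) ℂ) →ₗ[ℂ] (PBond (F.P K) 0 → Matrix (Fin N) (Fin N) ℂ)}
    (hKV : ∀ (A : PBond (F.P K) 0 → Matrix (Fin N) (Fin N) ℂ) (b : PBond (F.P K) 0),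
      KV A b = ∑ j, ((WithLp.ofLp ((dcsE c ∘ₗ dcE c) (WithLp.toLp 2 (Pi.single j 1))) b : ℝ) : ℂ) • A j)
    (Φ : TangentBondSU (F.P K) 0 N → TangentBondSU (F.P K) 0 N) (V : TangentBondSU (F.P K) 0 N → ℝ) (A₀ : TangentBondSU (F.P K) 0 N)
    (Wf : PBond (F.P K) 0 → Matrix (Fin N) (Fin N) ℂ)
    (hcrit : IsCritOnFibre F N K 𝔹 W (expChart 1 (WithLp.ofLp (Φ A₀))))
    (hΦ : ∀ δ : TangentBondSU (F.P K) 0 N,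
      (∀ (j : ℕ) (e : PBond (F.P K) j), Dm.LamBond j e →
        dIterL j (1 : PBond (F.P K) 0 → Matrix (Fin N) (Fin N) ℂ) (fun b => ((δ b : lieSU (Fin N)) : Matrix (Fin N) (Fin N) ℂ)) e = 0) →
      DifferentiableAt ℝ (fun s : ℝ => Φ (A₀ + s • δ)) 0)
    (hfib : ∀ δ : TangentBondSU (F.P K) 0 N,
      (∀ (j : ℕ) (e : PBond (F.P K) j), Dm.LamBond j e →
        dIterL j (1 : PBond (F.P K) 0 → Matrix (Fin N) (Fin N) ℂ) (fun b => ((δ b : lieSU (Fin N)) : Matrix (Fin N) (Fin N) ℂ)) e = 0) →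
      ∀ᶠ s in 𝓝 (0 : ℝ), AgreeOn 𝔹 (avgFamily (avOfRecord F N K) (expChart 1 (WithLp.ofLp (Φ (A₀ + s • δ))))) W)
    (h157 : ∀ (δ : TangentBondSU (F.P K) 0 N) (s : ℝ), wilsonAction4 (expChart (1 : GaugeField (F.P K) 0 (SU N)) (WithLp.ofLp (Φ (A₀ + s • δ)))) =
      2⁻¹ * ⟪A₀ + s • δ, hessOpAt η (1 : GaugeField (F.P K) 0 (SU N)) (A₀ + s • δ)⟫_ℝ + V (A₀ + s • δ))
    (hV : ∀ δ : TangentBondSU (F.P K) 0 N,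
      (∀ (j : ℕ) (e : PBond (F.P K) j), Dm.LamBond j e →
        dIterL j (1 : PBond (F.P K) 0 → Matrix (Fin N) (Fin N) ℂ) (fun b => ((δ b : lieSU (Fin N)) : Matrix (Fin N) (Fin N) ℂ)) e = 0) →
      HasDerivAt (fun s : ℝ => V (A₀ + s • δ)) (∑ b, ((((δ b : lieSU (Fin N)) : Matrix (Fin N) (Fin N) ℂ))ᴴ * Wf b).trace.re) 0) :
    ∀ δ : PBond (F.P K) 0 → lieSU (Fin N),
      (∀ (j : ℕ) (e : PBond (F.P K) j), Dm.LamBond j e →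
        dIterL j (1 : PBond (F.P K) 0 → Matrix (Fin N) (Fin N) ℂ) (fun b => (δ b : Matrix (Fin N) (Fin N) ℂ)) e = 0) →
      ∑ b, (((δ b : Matrix (Fin N) (Fin N) ℂ))ᴴ *
        (KV (fun b => ((A₀ b : lieSU (Fin N)) : Matrix (Fin N) (Fin N) ℂ)) b + (((N : ℝ) * c ^ 2) • Wf b))).trace.re = 0 := by
  refine (socket_curlCurlExt_iff_socket_hessOpAt_inner Dm hη hc hKV A₀ Wf).mpr fun δ hδ => ?_
  exact inner_hessOpAt_add_eq_zero_of_isCritOnFibre Φ V A₀ δ (hΦ δ hδ) (hfib δ hδ) hcrit (h157 δ) (hV δ hδ)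

end Crit

/-! ## §5 (v1.1)  The same spine for an ABSTRACT fibre — any set of configurations carrying criticality in the curve form
(for the ♭ road, whose chart lines stay in the fibres of the ♭ functional, and for any gauge-transported reading of the record's fibre) -/

section AbstractFibre

variable {P : Params} {N : ℕ} [NeZero N]

/-- ★★ **CRITICALITY ALONG A CHART LINE STAYING IN AN ABSTRACT FIBRE `𝓕`**: if the action is critical at `exp ⇑(Φ A₀)` along every matrix-differentiable curve
eventually in `𝓕` (the curve form of `Node00.IsCritOnFibre`, with the fibre abstracted to a SET of configurations), the chart line `s ↦ exp ⇑(Φ(A₀ + sδ))` stays in `𝓕`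
for small `s`, and `s ↦ Φ(A₀ + sδ)` is differentiable at `0`, then `d∕ds|₀ 𝔄(exp ⇑(Φ(A₀ + sδ))) = 0`.  Generic torus `P`, level `0`.
[cite: Balaban1985Variational, (82)-(83) p.290, (47) p.285; Balaban1988Convergent, (2.12) p.256] -/
theorem hasDerivAt_wilsonAction4_chartLine_zero_of_mem (𝓕 : Set (GaugeField P 0 (SU N)))
    (Φ : TangentBondSU P 0 N → TangentBondSU P 0 N) (A₀ δ : TangentBondSU P 0 N)
    (hΦ : DifferentiableAt ℝ (fun s : ℝ => Φ (A₀ + s • δ)) 0)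
    (hfib : ∀ᶠ s in 𝓝 (0 : ℝ), expChart (1 : GaugeField P 0 (SU N)) (WithLp.ofLp (Φ (A₀ + s • δ))) ∈ 𝓕)
    (hcrit : ∀ γ : ℝ → GaugeField P 0 (SU N), γ 0 = expChart 1 (WithLp.ofLp (Φ A₀)) →
      DifferentiableAt ℝ (fun (t : ℝ) (b : PBond P 0) => ((γ t b : SU N) : Matrix (Fin N) (Fin N) ℂ)) 0 →
        (∀ᶠ t in 𝓝 (0 : ℝ), γ t ∈ 𝓕) → HasDerivAt (fun t => wilsonAction4 (γ t)) 0 0) :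
    HasDerivAt (fun s : ℝ => wilsonAction4 (expChart (1 : GaugeField P 0 (SU N)) (WithLp.ofLp (Φ (A₀ + s • δ))))) 0 0 := by
  have hline : DifferentiableAt ℝ (fun s : ℝ => WithLp.ofLp (Φ (A₀ + s • δ))) 0 :=
    (PiLp.continuousLinearEquiv 2 ℝ (fun _ : PBond P 0 => lieSU (Fin N))).differentiableAt.comp (0 : ℝ) hΦ
  have hd : DifferentiableAt ℝ (fun (s : ℝ) (b : PBond P 0) =>
      ((expChart (1 : GaugeField P 0 (SU N)) (WithLp.ofLp (Φ (A₀ + s • δ))) b : SU N) : Matrix (Fin N) (Fin N) ℂ)) 0 :=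
    (((contDiff_coeField_expChart (1 : GaugeField P 0 (SU N))).differentiable (by simp)).differentiableAt).comp (0 : ℝ) hline
  have h0 : (fun s : ℝ => expChart (1 : GaugeField P 0 (SU N)) (WithLp.ofLp (Φ (A₀ + s • δ)))) 0 = expChart 1 (WithLp.ofLp (Φ A₀)) := by
    simp only [zero_smul, add_zero]
  exact hcrit _ h0 hd hfib

/-- ★★★ **THE SOCKET EQUATION FROM CRITICALITY ON AN ABSTRACT FIBRE**: §3 with the fibre abstracted — `⟪δ, Δ_1A₀⟫ + v = 0`.
[cite: Balaban1985Variational, (127)-(128) p.297, (157) p.302] -/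
theorem inner_hessOpAt_add_eq_zero_of_mem {η : ℝ} (𝓕 : Set (GaugeField P 0 (SU N)))
    (Φ : TangentBondSU P 0 N → TangentBondSU P 0 N) (V : TangentBondSU P 0 N → ℝ) (A₀ δ : TangentBondSU P 0 N)
    (hΦ : DifferentiableAt ℝ (fun s : ℝ => Φ (A₀ + s • δ)) 0)
    (hfib : ∀ᶠ s in 𝓝 (0 : ℝ), expChart (1 : GaugeField P 0 (SU N)) (WithLp.ofLp (Φ (A₀ + s • δ))) ∈ 𝓕)
    (hcrit : ∀ γ : ℝ → GaugeField P 0 (SU N), γ 0 = expChart 1 (WithLp.ofLp (Φ A₀)) →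
      DifferentiableAt ℝ (fun (t : ℝ) (b : PBond P 0) => ((γ t b : SU N) : Matrix (Fin N) (Fin N) ℂ)) 0 →
        (∀ᶠ t in 𝓝 (0 : ℝ), γ t ∈ 𝓕) → HasDerivAt (fun t => wilsonAction4 (γ t)) 0 0)
    (h157 : ∀ s : ℝ, wilsonAction4 (expChart (1 : GaugeField P 0 (SU N)) (WithLp.ofLp (Φ (A₀ + s • δ)))) =
      2⁻¹ * ⟪A₀ + s • δ, hessOpAt η (1 : GaugeField P 0 (SU N)) (A₀ + s • δ)⟫_ℝ + V (A₀ + s • δ))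
    {v : ℝ} (hV : HasDerivAt (fun s : ℝ => V (A₀ + s • δ)) v 0) :
    ⟪δ, hessOpAt η (1 : GaugeField P 0 (SU N)) A₀⟫_ℝ + v = 0 := by
  have hzero := hasDerivAt_wilsonAction4_chartLine_zero_of_mem 𝓕 Φ A₀ δ hΦ hfib hcrit
  have hsum : HasDerivAt (fun s : ℝ => wilsonAction4 (expChart (1 : GaugeField P 0 (SU N)) (WithLp.ofLp (Φ (A₀ + s • δ)))))
      (⟪δ, hessOpAt η (1 : GaugeField P 0 (SU N)) A₀⟫_ℝ + v) 0 := by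
    rw [show (fun s : ℝ => wilsonAction4 (expChart (1 : GaugeField P 0 (SU N)) (WithLp.ofLp (Φ (A₀ + s • δ))))) =
        fun s => 2⁻¹ * ⟪A₀ + s • δ, hessOpAt η (1 : GaugeField P 0 (SU N)) (A₀ + s • δ)⟫_ℝ + V (A₀ + s • δ) from funext h157]
    exact (hasDerivAt_inner_hessOpAt_line η 1 A₀ δ).add hV
  exact hsum.unique hzero

/-- ★★★ **`h127rec` FROM CRITICALITY ON AN ABSTRACT FIBRE** (§4 with the fibre abstracted): for every 𝔰𝔲(N)-valued test in the RECORD's multi-level kernel of a nested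
family `Dm`, D's binder with Hessian letter `K_V` and current `(N·c²)•Wf`. [cite: Balaban1985Variational, (127)-(128) p.297, (157) p.302; Balaban1984PropagatorsII, (2.19) p.226] -/
theorem h127rec_of_mem {η : ℝ} (hη : η ≠ 0) {c : ℝ} (hc : c ≠ 0) (𝓕 : Set (GaugeField P 0 (SU N)))
    (Dm : Domains P) {instDE : DecidableEq (PBond P 0)}
    {KV : (PBond P 0 → Matrix (Fin N) (Fin N) ℂ) →ₗ[ℂ] (PBond P 0 → Matrix (Fin N) (Fin N) ℂ)}
    (hKV : ∀ (A : PBond P 0 → Matrix (Fin N) (Fin N) ℂ) (b : PBond P 0),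
      KV A b = ∑ j, ((WithLp.ofLp ((dcsE c ∘ₗ dcE c) (WithLp.toLp 2 (Pi.single j 1))) b : ℝ) : ℂ) • A j)
    (Φ : TangentBondSU P 0 N → TangentBondSU P 0 N) (V : TangentBondSU P 0 N → ℝ) (A₀ : TangentBondSU P 0 N)
    (Wf : PBond P 0 → Matrix (Fin N) (Fin N) ℂ)
    (hcrit : ∀ γ : ℝ → GaugeField P 0 (SU N), γ 0 = expChart 1 (WithLp.ofLp (Φ A₀)) →
      DifferentiableAt ℝ (fun (t : ℝ) (b : PBond P 0) => ((γ t b : SU N) : Matrix (Fin N) (Fin N) ℂ)) 0 →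
        (∀ᶠ t in 𝓝 (0 : ℝ), γ t ∈ 𝓕) → HasDerivAt (fun t => wilsonAction4 (γ t)) 0 0)
    (hΦ : ∀ δ : TangentBondSU P 0 N,
      (∀ (j : ℕ) (e : PBond P j), Dm.LamBond j e →
        dIterL j (1 : PBond P 0 → Matrix (Fin N) (Fin N) ℂ) (fun b => ((δ b : lieSU (Fin N)) : Matrix (Fin N) (Fin N) ℂ)) e = 0) →
      DifferentiableAt ℝ (fun s : ℝ => Φ (A₀ + s • δ)) 0)
    (hfib : ∀ δ : TangentBondSU P 0 N,
      (∀ (j : ℕ) (e : PBond P j), Dm.LamBond j e →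
        dIterL j (1 : PBond P 0 → Matrix (Fin N) (Fin N) ℂ) (fun b => ((δ b : lieSU (Fin N)) : Matrix (Fin N) (Fin N) ℂ)) e = 0) →
      ∀ᶠ s in 𝓝 (0 : ℝ), expChart (1 : GaugeField P 0 (SU N)) (WithLp.ofLp (Φ (A₀ + s • δ))) ∈ 𝓕)
    (h157 : ∀ (δ : TangentBondSU P 0 N) (s : ℝ), wilsonAction4 (expChart (1 : GaugeField P 0 (SU N)) (WithLp.ofLp (Φ (A₀ + s • δ)))) =
      2⁻¹ * ⟪A₀ + s • δ, hessOpAt η (1 : GaugeField P 0 (SU N)) (A₀ + s • δ)⟫_ℝ + V (A₀ + s • δ))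
    (hV : ∀ δ : TangentBondSU P 0 N,
      (∀ (j : ℕ) (e : PBond P j), Dm.LamBond j e →
        dIterL j (1 : PBond P 0 → Matrix (Fin N) (Fin N) ℂ) (fun b => ((δ b : lieSU (Fin N)) : Matrix (Fin N) (Fin N) ℂ)) e = 0) →
      HasDerivAt (fun s : ℝ => V (A₀ + s • δ)) (∑ b, ((((δ b : lieSU (Fin N)) : Matrix (Fin N) (Fin N) ℂ))ᴴ * Wf b).trace.re) 0) :
    ∀ δ : PBond P 0 → lieSU (Fin N),
      (∀ (j : ℕ) (e : PBond P j), Dm.LamBond j e →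
        dIterL j (1 : PBond P 0 → Matrix (Fin N) (Fin N) ℂ) (fun b => (δ b : Matrix (Fin N) (Fin N) ℂ)) e = 0) →
      ∑ b, (((δ b : Matrix (Fin N) (Fin N) ℂ))ᴴ *
        (KV (fun b => ((A₀ b : lieSU (Fin N)) : Matrix (Fin N) (Fin N) ℂ)) b + (((N : ℝ) * c ^ 2) • Wf b))).trace.re = 0 := by
  refine (socket_curlCurlExt_iff_socket_hessOpAt_inner Dm hη hc hKV A₀ Wf).mpr fun δ hδ => ?_
  exact inner_hessOpAt_add_eq_zero_of_mem 𝓕 Φ V A₀ δ (hΦ δ hδ) (hfib δ hδ) hcrit (h157 δ) (hV δ hδ)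

/-- The record's fibre is an instance: `IsCritOnFibre F N K 𝔹 W` IS curve-criticality on the set `{U | AgreeOn 𝔹 (avgFamily (avOfRecord F N K) U) W}`.
[cite: Balaban1985Variational, (5)-(6) p.278; Balaban1988Convergent, (2.12) p.256] -/
theorem curveCritical_of_isCritOnFibre {F : T4Family} {K : ℕ} {𝔹 : DetSet (F.P K)} {W : MSField (F.P K) (SU N)} {U : GaugeField (F.P K) 0 (SU N)}
    (hcrit : IsCritOnFibre F N K 𝔹 W U) :
    ∀ γ : ℝ → GaugeField (F.P K) 0 (SU N), γ 0 = U →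
      DifferentiableAt ℝ (fun (t : ℝ) (b : PBond (F.P K) 0) => ((γ t b : SU N) : Matrix (Fin N) (Fin N) ℂ)) 0 →
        (∀ᶠ t in 𝓝 (0 : ℝ), γ t ∈ {U' | AgreeOn 𝔹 (avgFamily (avOfRecord F N K) U') W}) → HasDerivAt (fun t => wilsonAction4 (γ t)) 0 0 :=
  fun γ h0 hd hf => (isCritOnFibre_iff_hasDerivAt_zero.mp hcrit) γ h0 hd hf

end AbstractFibre

end Summit.QuantumFields.YangMills.BalabanUVNodes.N07SocketOfChartedCriticality
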